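import Literature.NumberTheory.Sieve.BrunPureSieve
import Literature.NumberTheory.Sieve.SingularSeries
import Literature.NumberTheory.LFunctions.MertensElementary
import Literature.NumberTheory.Sieve.BombieriAsymptoticSieveMertens
import Literature.NumberTheory.LFunctions.TaoCircleMethod
import Mathlib.Combinatorics.Additive.Energy
import Mathlib.Data.Nat.ChineseRemainder
import Mathlib.RingTheory.Coprime.Lemmas
import HarnessLib

/-!
# Brun's pure sieve with two residue classes: an upper bound for Goldbach-type representations

Topic `Literature/NumberTheory/Sieve`. Everything in this file is PROVED (no named facts).

The elementary upper bound
`R_N(m) = #{n ≤ N : n and m - n both prime} ≤ C N (log log N)³ / (log N)²` for `1 ≤ m ≤ 2N`,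
`N ≥ N₀`, by Brun's pure sieve (Bonferroni truncation of inclusion–exclusion, the tree's
`Literature.NumberTheory.Sieve.BrunPureSieve`) sifting out the two classes `0, m (mod p)` for the
primes `p < z = exp(log N / (40 log log N))`. The sharp order is `𝔖(m) N / log² N`
(Selberg's sieve; Halberstam–Richert, *Sieve Methods*, Thm 3.11); the pure sieve loses a power
of `log log N`.

**Position in the tree.** `Sieve/ShiftedPrimePairs.lean` (namespace `Literature.ShiftedPrimePairs`) proves
the same kind of Brun pair bound, uniform in the shift, for primes in a window `[z, N]`, with a
`(log log N)⁶` loss, and its energy corollary `exists_eventually_card_addQuadruples_le`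
(`#quadruples ≤ C N (log log N)⁸/log² N · #𝒫²`) for the consumers
`Literature.NumberTheory.LFunctions.Tao2016.card_largeFreq_le` (`LFunctions/TaoCircleMethod`) and `Literature.NumberTheory.LFunctions.Tao2016.card_Xi_le`
(`LFunctions/TaoLogElliottCircleMethod`) in the proof of Tao 2016, Lemma 3.7. What is new here:
the exponent `3` (via `prod_one_sub_localDensity_le` and `m/φ(m) ≪ log log N`), the statement
for an arbitrary finite set of primes, an upper bound for the tree's `Literature.NumberTheory.Sieve.SingularSeries.goldbachCount` itself
(`exists_goldbachCount_le`), and `brun_sieve_local`, a pure sieve for general local conditions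
`A_p` which generalises `ShiftedPrimePairs.pure_sieve_le` and `BrunTwinPrimes.twin_pure_sieve_le`.
The energy bound `card_addQuadruples_le` is stated for Mathlib's `Finset.addEnergy P P`, which is
`#(Tao2016.addQuadruples P)` by `rfl` (`addEnergy_eq_card_addQuadruples`), and assembled in the
consumers' shape in `exists_eventually_card_addQuadruples_le` (`(log log N)³` in place of
`(log log N)⁸`).

**What this yields for Tao 2016, Lemma 3.7:** footnote 5 of the paper bounds the number of
quadruples `p₁ + p₂ = p₃ + p₄` in `𝒫_H` by `O_ε(H³/log⁴ H)`, giving Lemma 3.7 as printed,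
`|Ξ_H| ≪_{a,h,ε} 1`. The route of this file (`#quadruples ≤ #𝒫² · max_m R(m)`) only gives
`#quadruples ≪ H³ (log log H)³/log⁴ H`, hence `|Ξ_H| ≪ (log log H)³`; the printed order is not
obtained here (it would need the Selberg-sieve bound for `R(m)` together with an average of the
singular series `𝔖(p₁ + p₂)` over the quadruples, cf. `ShiftedPrimePairs.card_addQuadruples_eq_sum_sq`).
The weaker count suffices when it is multiplied by the Matomäki–Radziwiłł–Tao gain
`log log H/log H` of Proposition 2.4, as in the Liouville case of Theorem 2.3.

## References
* A. C. Cojocaru, M. R. Murty, *An Introduction to Sieve Methods and their Applications*,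
  CUP 2005, §6.1 (Brun's pure sieve).
* H. Halberstam, H.-E. Richert, *Sieve Methods*, Academic Press 1974, Thm 3.11 (the sharp form).
* G. H. Hardy, E. M. Wright, *An Introduction to the Theory of Numbers*, Thms 328, 429
  (via `MertensElementary` and `BombieriAsymptoticSieveMertens`).
* T. Tao, *The logarithmically averaged Chowla and Elliott conjectures for two-point
  correlations*, Forum Math. Pi 4 (2016), e8, §3, footnote 5 to the proof of Lemma 3.7.

## Design choices
* All constants explicit inside the proofs; the final statements are existential in `C, N₀`.
* `m - n` is natural subtraction; for `n > m` it is `0`, not prime, so `repCount` counts genuine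
  representations `m = n + (m - n)`.
-/

open Finset Real

namespace Literature.NumberTheory.Sieve

namespace BrunGoldbach

/-! ### Counting integers in residue classes -/

/-- Integers `n ∈ [1, N]` with `n % d = r` (`r < d`): there are `N/d + θ` of them, `|θ| ≤ 1`.
[folklore] -/
theorem abs_card_filter_mod_sub_le (N : ℕ) {d r : ℕ} (hr : r < d) :
    |(#{n ∈ Icc 1 N | n % d = r} : ℝ) - N / d| ≤ 1 := by
  have hd : 1 ≤ d := by omega
  -- shift by `d - r` to land on multiples of `d`
  have hcard : #{n ∈ Icc 1 N | n % d = r} = #{m ∈ Icc (1 + (d - r)) (N + (d - r)) | d ∣ m} := by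
    refine card_nbij' (fun n => n + (d - r)) (fun m => m - (d - r)) ?_ ?_ ?_ ?_
    · intro n hn
      dsimp only
      rw [mem_coe, mem_filter, mem_Icc] at hn ⊢
      obtain ⟨⟨h1, h2⟩, h3⟩ := hn
      refine ⟨⟨by omega, by omega⟩, ?_⟩
      have := Nat.div_add_mod n d
      exact ⟨n / d + 1, by rw [mul_add, mul_one]; omega⟩
    · intro m hm
      dsimp only
      rw [mem_coe, mem_filter, mem_Icc] at hm ⊢
      obtain ⟨⟨h1, h2⟩, k, hk⟩ := hm
      refine ⟨⟨by omega, by omega⟩, ?_⟩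
      have hk1 : 1 ≤ k := by
        rcases k with _ | k
        · omega
        · omega
      have : m - (d - r) = r + d * (k - 1) := by
        rw [hk]
        rcases k with _ | k
        · omega
        · simp only [add_tsub_cancel_right]
          rw [mul_add, mul_one]
          omega
      rw [this, Nat.add_mul_mod_self_left, Nat.mod_eq_of_lt hr]
    · intro n _
      simp
    · intro m hm
      dsimp only
      rw [mem_coe, mem_filter, mem_Icc] at hm
      omega
  rw [hcard]
  have h := BrunPureSieve.abs_card_Icc_filter_dvd_sub_le (a := 1 + (d - r)) (b := N + (d - r))
    (by omega) (by omega) hd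
  have hcast : ((N + (d - r) : ℕ) : ℝ) + 1 - ((1 + (d - r) : ℕ) : ℝ) = N := by
    push_cast
    ring
  rwa [hcast] at h

/-- **Chinese remainder theorem** for a finite set `S` of primes: a system `n ≡ c_p (mod p)`,
`p ∈ S`, is one congruence `n ≡ r (mod ∏_{p ∈ S} p)` with `r < ∏ p`. [folklore] -/
theorem exists_forall_mod_eq_iff (S : Finset ℕ) (hS : ∀ p ∈ S, p.Prime) (c : ℕ → ℕ) :
    ∃ r < ∏ p ∈ S, p, ∀ n : ℕ, (∀ p ∈ S, n % p = c p % p) ↔ n % (∏ p ∈ S, p) = r := by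
  have hs : ∀ p ∈ S, (id p : ℕ) ≠ 0 := fun p hp => (hS p hp).ne_zero
  have hpp : Set.Pairwise (S : Set ℕ) (Function.onFun Nat.Coprime id) := by
    intro p hp q hq hpq
    exact (Nat.coprime_primes (hS p hp) (hS q hq)).2 hpq
  set k := Nat.chineseRemainderOfFinset c id S hs hpp with hk
  have hklt : (k : ℕ) < ∏ p ∈ S, p := by
    have := Nat.chineseRemainderOfFinset_lt_prod c id (t := S) hs hpp
    simpa using this
  have hkmod : ∀ p ∈ S, (k : ℕ) ≡ c p [MOD p] := k.2
  set d := ∏ p ∈ S, p with hd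
  refine ⟨k, hklt, fun n => ⟨fun h => ?_, fun h => ?_⟩⟩
  · -- every `p ∈ S` divides `n - k`, hence so does `d`
    have hdvd : ∀ p ∈ S, (p : ℤ) ∣ (n : ℤ) - k := by
      intro p hp
      have h1 : (k : ℕ) ≡ n [MOD p] := ((hkmod p hp).trans (by
        show c p ≡ n [MOD p]
        exact ((Nat.mod_modEq (c p) p).symm.trans (by rw [← h p hp]; exact Nat.mod_modEq n p))))
      exact (Nat.modEq_iff_dvd.1 h1)
    have hcop : Set.Pairwise (S : Set ℕ) (Function.onFun IsCoprime fun p : ℕ => (p : ℤ)) := by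
      intro p hp q hq hpq
      exact Nat.isCoprime_iff_coprime.2 ((Nat.coprime_primes (hS p hp) (hS q hq)).2 hpq)
    have hd_dvd : (d : ℤ) ∣ (n : ℤ) - k := by
      have := Finset.prod_dvd_of_coprime hcop hdvd
      push_cast [hd]
      exact this
    have hmod : (k : ℕ) ≡ n [MOD d] := Nat.modEq_iff_dvd.2 hd_dvd
    rw [← Nat.mod_eq_of_lt hklt]
    exact hmod.symm
  · intro p hp
    have hpd : p ∣ d := dvd_prod_of_mem _ hp
    have h1 : n ≡ k [MOD d] := by
      have := Nat.mod_modEq n d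
      rw [h] at this
      exact this.symm
    have h2 : n ≡ k [MOD p] := h1.of_dvd hpd
    have h3 : n ≡ c p [MOD p] := h2.trans (hkmod p hp)
    exact h3

/-- Counting a full system of congruences in `[1, N]`: `N / ∏ p + θ`, `|θ| ≤ 1`. [folklore] -/
theorem abs_card_filter_forall_mod_eq_sub_le (N : ℕ) (S : Finset ℕ) (hS : ∀ p ∈ S, p.Prime)
    (c : ℕ → ℕ) :
    |(#{n ∈ Icc 1 N | ∀ p ∈ S, n % p = c p % p} : ℝ) - N / ∏ p ∈ S, (p : ℝ)| ≤ 1 := by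
  obtain ⟨r, hr, hiff⟩ := exists_forall_mod_eq_iff S hS c
  have : (Icc 1 N).filter (fun n => ∀ p ∈ S, n % p = c p % p) =
      (Icc 1 N).filter (fun n => n % (∏ p ∈ S, p) = r) := filter_congr fun n _ => hiff n
  rw [this]
  have h := abs_card_filter_mod_sub_le N hr
  push_cast at h
  exact h

/-- **Counting with local conditions.** For local sets `A_p ⊆ {0, …, p-1}` (`p ∈ S`, primes):
`|#{n ∈ [1, N] : n mod p ∈ A_p ∀ p ∈ S} - N ∏_{p ∈ S} #A_p / p| ≤ ∏_{p ∈ S} #A_p`.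
[folklore] -/
theorem abs_card_filter_forall_mod_mem_sub_le (N : ℕ) (S : Finset ℕ) (hS : ∀ p ∈ S, p.Prime)
    (A : ℕ → Finset ℕ) (hA : ∀ p ∈ S, ∀ x ∈ A p, x < p) :
    |(#{n ∈ Icc 1 N | ∀ p ∈ S, n % p ∈ A p} : ℝ) - N * ∏ p ∈ S, ((#(A p) : ℝ) / p)| ≤
      ∏ p ∈ S, (#(A p) : ℝ) := by
  classical
  set T := (Icc 1 N).filter (fun n => ∀ p ∈ S, n % p ∈ A p) with hT
  -- fibre decomposition over the residue vector
  set g : ℕ → ((p : ℕ) → p ∈ S → ℕ) := fun n p _ => n % p with hg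
  have hmaps : ∀ n ∈ T, g n ∈ S.pi A := by
    intro n hn
    rw [Finset.mem_pi]
    intro p hp
    exact (mem_filter.1 hn).2 p hp
  have hdecomp := card_eq_sum_card_fiberwise hmaps
  -- each fibre is a full system of congruences
  have hfib : ∀ f ∈ S.pi A, |(#{n ∈ T | g n = f} : ℝ) - N / ∏ p ∈ S, (p : ℝ)| ≤ 1 := by
    intro f hf
    set c : ℕ → ℕ := fun p => if hp : p ∈ S then f p hp else 0 with hc
    have hcp : ∀ p (hp : p ∈ S), c p % p = f p hp := by
      intro p hp
      rw [hc]
      simp only [hp, ↓reduceDIte]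
      exact Nat.mod_eq_of_lt (hA p hp _ (Finset.mem_pi.1 hf p hp))
    have hset : T.filter (fun n => g n = f) = (Icc 1 N).filter (fun n => ∀ p ∈ S, n % p = c p % p) := by
      rw [hT, filter_filter]
      refine filter_congr fun n _ => ⟨fun ⟨_, h2⟩ p hp => ?_, fun h => ⟨fun p hp => ?_, ?_⟩⟩
      · rw [hcp p hp, ← h2]
      · rw [h p hp, hcp p hp]
        exact Finset.mem_pi.1 hf p hp
      · funext p hp
        rw [hg]
        simp only
        rw [h p hp, hcp p hp]
    rw [hset]
    exact abs_card_filter_forall_mod_eq_sub_le N S hS c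
  -- sum the fibres
  have hcardpi : (#(S.pi A) : ℝ) = ∏ p ∈ S, (#(A p) : ℝ) := by
    rw [Finset.card_pi]; push_cast; rfl
  have hprod : (N : ℝ) * ∏ p ∈ S, ((#(A p) : ℝ) / p) = #(S.pi A) * (N / ∏ p ∈ S, (p : ℝ)) := by
    rw [hcardpi, prod_div_distrib]; ring
  rw [hdecomp, hprod]
  push_cast
  calc |∑ f ∈ S.pi A, (#{n ∈ T | g n = f} : ℝ) - #(S.pi A) * (N / ∏ p ∈ S, (p : ℝ))|
      = |∑ f ∈ S.pi A, ((#{n ∈ T | g n = f} : ℝ) - N / ∏ p ∈ S, (p : ℝ))| := by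
        rw [sum_sub_distrib, sum_const, nsmul_eq_mul]
    _ ≤ ∑ f ∈ S.pi A, |(#{n ∈ T | g n = f} : ℝ) - N / ∏ p ∈ S, (p : ℝ)| := abs_sum_le_sum_abs _ _
    _ ≤ ∑ f ∈ S.pi A, (1 : ℝ) := sum_le_sum hfib
    _ = ∏ p ∈ S, (#(A p) : ℝ) := by rw [sum_const, nsmul_eq_mul, mul_one, hcardpi]

/-! ### Brun's pure sieve with general local conditions -/

/-- **Brun's pure sieve, local-set form** (Cojocaru–Murty §6.1 (6.5) with the main term
treated by Bonferroni, as in `Literature.NumberTheory.Sieve.BrunPureSieve.brun_pure_sieve_Icc`, now sifting out, for each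
prime `p ∈ P`, a set `A_p` of `ν(p) = #A_p` residue classes): for even `r`,
`#{n ∈ [1, N] : n mod p ∉ A_p ∀ p ∈ P}
  ≤ N (∏_{p ∈ P} (1 - ν(p)/p) + ∑_{#S = r+1} ∏_{p ∈ S} ν(p)/p) + ∑_{k ≤ r} ∑_{#S = k} ∏_{p∈S} ν(p)`.
[cite: CojocaruMurty2005, §6.1 (6.5) and Lemma 6.1.1] -/
theorem brun_sieve_local (N : ℕ) (P : Finset ℕ) (hP : ∀ p ∈ P, p.Prime) (A : ℕ → Finset ℕ)
    (hA : ∀ p ∈ P, ∀ x ∈ A p, x < p) {r : ℕ} (hr : Even r) :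
    (#{n ∈ Icc 1 N | ∀ p ∈ P, n % p ∉ A p} : ℝ) ≤
      N * (∏ p ∈ P, (1 - (#(A p) : ℝ) / p) +
          ∑ S ∈ P.powersetCard (r + 1), ∏ p ∈ S, ((#(A p) : ℝ) / p)) +
        ∑ k ∈ range (r + 1), ∑ S ∈ P.powersetCard k, ∏ p ∈ S, (#(A p) : ℝ) := by
  classical
  -- Step 1: counting Bonferroni
  have step1 := BrunPureSieve.card_filter_forall_not_le_bonferroniSum (Icc 1 N) P
    (fun p n => n % p ∈ A p) hr
  -- Step 2: each term
  have step2 : ∀ k ∈ range (r + 1), ∀ S ∈ P.powersetCard k,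
      (-1 : ℝ) ^ k * (#{n ∈ Icc 1 N | ∀ p ∈ S, n % p ∈ A p} : ℝ) ≤
        (-1 : ℝ) ^ k * (N * ∏ p ∈ S, ((#(A p) : ℝ) / p)) + ∏ p ∈ S, (#(A p) : ℝ) := by
    intro k _ S hS
    have hSP : S ⊆ P := (mem_powersetCard.mp hS).1
    have habs := abs_card_filter_forall_mod_mem_sub_le N S (fun p hp => hP p (hSP hp)) A
      (fun p hp => hA p (hSP hp))
    rw [abs_le] at habs
    rcases neg_one_pow_eq_or ℝ k with h1 | h1 <;> rw [h1] <;> linarith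
  -- Step 3: sum up
  have step3 : ∑ k ∈ range (r + 1), (-1 : ℝ) ^ k *
      ∑ S ∈ P.powersetCard k, (#{n ∈ Icc 1 N | ∀ p ∈ S, n % p ∈ A p} : ℝ) ≤
      N * ∑ k ∈ range (r + 1), (-1 : ℝ) ^ k * ∑ S ∈ P.powersetCard k, ∏ p ∈ S, ((#(A p) : ℝ) / p)
        + ∑ k ∈ range (r + 1), ∑ S ∈ P.powersetCard k, ∏ p ∈ S, (#(A p) : ℝ) := by
    calc ∑ k ∈ range (r + 1), (-1 : ℝ) ^ k *
          ∑ S ∈ P.powersetCard k, (#{n ∈ Icc 1 N | ∀ p ∈ S, n % p ∈ A p} : ℝ)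
        = ∑ k ∈ range (r + 1), ∑ S ∈ P.powersetCard k,
            (-1 : ℝ) ^ k * (#{n ∈ Icc 1 N | ∀ p ∈ S, n % p ∈ A p} : ℝ) := by
          simp_rw [Finset.mul_sum]
      _ ≤ ∑ k ∈ range (r + 1), ∑ S ∈ P.powersetCard k,
            ((-1 : ℝ) ^ k * (N * ∏ p ∈ S, ((#(A p) : ℝ) / p)) + ∏ p ∈ S, (#(A p) : ℝ)) :=
          sum_le_sum fun k hk => sum_le_sum fun S hS => step2 k hk S hS
      _ = _ := by
          simp_rw [sum_add_distrib, Finset.mul_sum]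
          congr 1
          refine sum_congr rfl fun k _ => sum_congr rfl fun S _ => by ring
  -- Step 4: Bonferroni for the product
  have step4 := BrunPureSieve.bonferroniSum_le_prod_one_sub_add P (fun p => (#(A p) : ℝ) / p)
    (fun p _ => by positivity) (fun p hp => by
      have hp0 : (0 : ℝ) < p := by exact_mod_cast (hP p hp).pos
      rw [div_le_one hp0]
      have : #(A p) ≤ #(range p) := card_le_card fun x hx => mem_range.2 (hA p hp x hx)
      rw [card_range] at this
      exact_mod_cast this) hr
  calc (#{n ∈ Icc 1 N | ∀ p ∈ P, n % p ∉ A p} : ℝ) ≤ _ := step1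
    _ ≤ _ := step3
    _ ≤ _ := by gcongr

/-! ### Goldbach-type representations -/

/-- The *windowed* representation count `R_N(m) = #{n ∈ [1, N] : n and m - n both prime}`:
the number of Goldbach-type representations `m = n + (m - n)` whose first summand lies in the
sifted interval `[1, N]`. This is the quantity Brun's sieve bounds directly (one sifts the fixed
interval `[1, N]` uniformly in `m ≤ 2N`); it is a truncation of the tree's Goldbach representation
number `Literature.goldbachCount m = #{(p, q) : p + q = m, p, q prime}` (`SingularSeries`):
`repCount N m ≤ goldbachCount m` always, with equality for `m ≤ N`, and
`goldbachCount m ≤ 2 repCount N m` for `m ≤ 2N` (`repCount_le_goldbachCount`,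
`repCount_eq_goldbachCount_of_le`, `goldbachCount_le_two_mul_repCount`); the headline bound is
restated for `goldbachCount` in `exists_goldbachCount_le`. [folklore] -/
def repCount (N m : ℕ) : ℕ := #{n ∈ Icc 1 N | n.Prime ∧ (m - n).Prime}

/-- `R_N(m) ≤ goldbachCount m`: `n ↦ (n, m - n)` is injective into the representations.
[folklore] -/
theorem repCount_le_goldbachCount (N m : ℕ) : repCount N m ≤ SingularSeries.goldbachCount m := by
  unfold repCount SingularSeries.goldbachCount
  refine card_le_card_of_injOn (fun n => (n, m - n)) (fun n hn => ?_) (fun n _ n' _ h => ?_)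
  · dsimp only
    rw [mem_coe, mem_filter, mem_Icc] at hn
    obtain ⟨_, hp1, hp2⟩ := hn
    have hnm : n ≤ m := by
      by_contra h
      rw [Nat.sub_eq_zero_of_le (by omega)] at hp2
      exact Nat.not_prime_zero hp2
    rw [mem_coe, mem_filter, HasAntidiagonal.mem_antidiagonal]
    exact ⟨by omega, hp1, hp2⟩
  · dsimp only at h
    exact (Prod.ext_iff.1 h).1

/-- `R_N(m) = goldbachCount m` for `m ≤ N`. [folklore] -/
theorem repCount_eq_goldbachCount_of_le {N m : ℕ} (hm : m ≤ N) : repCount N m = SingularSeries.goldbachCount m := by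
  refine le_antisymm (repCount_le_goldbachCount N m) ?_
  unfold repCount SingularSeries.goldbachCount
  refine card_le_card_of_injOn (fun pq => pq.1) (fun pq hpq => ?_) (fun pq hpq pq' hpq' h => ?_)
  · dsimp only
    rw [mem_coe, mem_filter, HasAntidiagonal.mem_antidiagonal] at hpq
    obtain ⟨hsum, hp1, hp2⟩ := hpq
    rw [mem_coe, mem_filter, mem_Icc]
    refine ⟨⟨hp1.one_lt.le, by omega⟩, hp1, ?_⟩
    rw [show m - pq.1 = pq.2 by omega]; exact hp2
  · dsimp only at h
    rw [mem_coe, mem_filter, HasAntidiagonal.mem_antidiagonal] at hpq hpq'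
    exact Prod.ext h (by omega)

/-- `goldbachCount m ≤ 2 R_N(m)` for `m ≤ 2N`: in a representation `p + q = m` one of `p, q`
is `≤ N`. [folklore] -/
theorem goldbachCount_le_two_mul_repCount {N m : ℕ} (hm : m ≤ 2 * N) :
    SingularSeries.goldbachCount m ≤ 2 * repCount N m := by
  classical
  unfold repCount SingularSeries.goldbachCount
  set G := (antidiagonal m).filter (fun pq => pq.1.Prime ∧ pq.2.Prime) with hG
  set W := (Icc 1 N).filter (fun n => n.Prime ∧ (m - n).Prime) with hW
  have hsplit : G ⊆ G.filter (fun pq => pq.1 ≤ N) ∪ G.filter (fun pq => pq.2 ≤ N) := by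
    intro pq hpq
    have := (mem_filter.1 hpq).1
    rw [HasAntidiagonal.mem_antidiagonal] at this
    by_cases h : pq.1 ≤ N
    · exact mem_union_left _ (mem_filter.2 ⟨hpq, h⟩)
    · exact mem_union_right _ (mem_filter.2 ⟨hpq, by omega⟩)
  have h1 : #(G.filter fun pq => pq.1 ≤ N) ≤ #W := by
    refine card_le_card_of_injOn (fun pq => pq.1) (fun pq hpq => ?_) (fun pq hpq pq' hpq' h => ?_)
    · dsimp only
      rw [mem_coe, mem_filter, hG, mem_filter, HasAntidiagonal.mem_antidiagonal] at hpq
      obtain ⟨⟨hsum, hp1, hp2⟩, hle⟩ := hpq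
      rw [mem_coe, hW, mem_filter, mem_Icc]
      refine ⟨⟨hp1.one_lt.le, hle⟩, hp1, ?_⟩
      rw [show m - pq.1 = pq.2 by omega]; exact hp2
    · dsimp only at h
      rw [mem_coe, mem_filter, hG, mem_filter, HasAntidiagonal.mem_antidiagonal] at hpq hpq'
      exact Prod.ext h (by omega)
  have h2 : #(G.filter fun pq => pq.2 ≤ N) ≤ #W := by
    refine card_le_card_of_injOn (fun pq => pq.2) (fun pq hpq => ?_) (fun pq hpq pq' hpq' h => ?_)
    · dsimp only
      rw [mem_coe, mem_filter, hG, mem_filter, HasAntidiagonal.mem_antidiagonal] at hpq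
      obtain ⟨⟨hsum, hp1, hp2⟩, hle⟩ := hpq
      rw [mem_coe, hW, mem_filter, mem_Icc]
      refine ⟨⟨hp2.one_lt.le, hle⟩, hp2, ?_⟩
      rw [show m - pq.2 = pq.1 by omega]; exact hp1
    · dsimp only at h
      rw [mem_coe, mem_filter, hG, mem_filter, HasAntidiagonal.mem_antidiagonal] at hpq hpq'
      exact Prod.ext (by omega) h
  calc #G ≤ #(G.filter (fun pq => pq.1 ≤ N) ∪ G.filter (fun pq => pq.2 ≤ N)) := card_le_card hsplit
    _ ≤ #(G.filter fun pq => pq.1 ≤ N) + #(G.filter fun pq => pq.2 ≤ N) := card_union_le _ _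
    _ ≤ #W + #W := add_le_add h1 h2
    _ = 2 * #W := by ring

/-- **Reduction to a sieve problem**: if `n` and `m - n` are primes `≥ z`, then `n` avoids the
classes `0` and `m` modulo every prime `p < z`; hence
`R_N(m) ≤ 2z + #{n ∈ [1, N] : n mod p ∉ {0, m mod p} ∀ p < z}`. [folklore] -/
theorem repCount_le_sifted (N m z : ℕ) :
    (repCount N m : ℝ) ≤ 2 * z +
      #{n ∈ Icc 1 N | ∀ p ∈ Nat.primesBelow z, n % p ∉ ({0, m % p} : Finset ℕ)} := by
  classical
  unfold repCount
  set T := (Icc 1 N).filter (fun n => n.Prime ∧ (m - n).Prime) with hT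
  -- split `T` according to `n < z`, `m - n < z`, or neither
  have hsplit : T ⊆ (range z) ∪ ((range z).image (fun k => m - k)) ∪
      (Icc 1 N).filter (fun n => ∀ p ∈ Nat.primesBelow z, n % p ∉ ({0, m % p} : Finset ℕ)) := by
    intro n hn
    rw [hT, mem_filter] at hn
    obtain ⟨hnI, hnp, hmnp⟩ := hn
    rw [mem_union, mem_union]
    by_cases h1 : n < z
    · exact Or.inl (Or.inl (mem_range.2 h1))
    by_cases h2 : m - n < z
    · refine Or.inl (Or.inr (mem_image.2 ⟨m - n, mem_range.2 h2, ?_⟩))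
      have : n ≤ m := by
        by_contra hcon
        have : m - n = 0 := by omega
        rw [this] at hmnp
        exact Nat.not_prime_zero hmnp
      omega
    rw [not_lt] at h1 h2
    refine Or.inr (mem_filter.2 ⟨hnI, fun p hp hmem => ?_⟩)
    rw [Nat.mem_primesBelow] at hp
    rw [mem_insert, mem_singleton] at hmem
    rcases hmem with h0 | hm0
    · -- `p ∣ n`, `n` prime, `p < z ≤ n`
      have hpn : p ∣ n := Nat.dvd_of_mod_eq_zero h0
      have := (Nat.prime_dvd_prime_iff_eq hp.2 hnp).1 hpn
      omega
    · -- `p ∣ m - n`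
      have hle : n ≤ m := by omega
      have hpmn : p ∣ m - n := by
        have : (m - n) % p = 0 := by
          rw [← Nat.sub_mod_eq_zero_of_mod_eq hm0.symm]
        exact Nat.dvd_of_mod_eq_zero this
      have := (Nat.prime_dvd_prime_iff_eq hp.2 hmnp).1 hpmn
      omega
  calc (#T : ℝ) ≤ #((range z) ∪ ((range z).image (fun k => m - k)) ∪
      (Icc 1 N).filter (fun n => ∀ p ∈ Nat.primesBelow z, n % p ∉ ({0, m % p} : Finset ℕ))) := by
        exact_mod_cast card_le_card hsplit
    _ ≤ #(range z) + #((range z).image (fun k => m - k)) +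
        #((Icc 1 N).filter (fun n => ∀ p ∈ Nat.primesBelow z, n % p ∉ ({0, m % p} : Finset ℕ))) := by
        have h1 := card_union_le ((range z) ∪ ((range z).image (fun k => m - k)))
          ((Icc 1 N).filter (fun n => ∀ p ∈ Nat.primesBelow z, n % p ∉ ({0, m % p} : Finset ℕ)))
        have h2 := card_union_le (range z) ((range z).image (fun k => m - k))
        exact_mod_cast h1.trans (Nat.add_le_add_right h2 _)
    _ ≤ z + z + _ := by
        gcongr
        · exact_mod_cast (card_range z).le
        · exact_mod_cast card_image_le.trans (card_range z).le
    _ = 2 * z + _ := by ring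

/-! ### Estimates for the sieve terms -/

/-- The local densities of the Goldbach problem: `#{0, m mod p} = 1` if `p ∣ m`, else `2`.
[folklore] -/
theorem card_pair_zero_mod (m p : ℕ) :
    #({0, m % p} : Finset ℕ) = if p ∣ m then 1 else 2 := by
  by_cases h : p ∣ m
  · rw [if_pos h, Nat.mod_eq_zero_of_dvd h]
    simp
  · rw [if_neg h, card_pair]
    intro h0
    exact h (Nat.dvd_of_mod_eq_zero h0.symm)

/-- **The main term of the two-class sieve**: for `m ≥ 1`,
`∏_{p < z} (1 - ν_m(p)/p) ≤ (∏_{p < z} (1 - 1/p))² · m/φ(m)`, where `ν_m(p) = #{0, m mod p}`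
(use `1 - 2/p ≤ (1 - 1/p)²` for `p ∤ m` and `∏_{p ∣ m} (1 - 1/p) = φ(m)/m`). [folklore] -/
theorem prod_one_sub_localDensity_le (z : ℕ) {m : ℕ} (hm : 1 ≤ m) :
    ∏ p ∈ Nat.primesBelow z, (1 - (#({0, m % p} : Finset ℕ) : ℝ) / p) ≤
      (∏ p ∈ Nat.primesBelow z, (1 - 1 / (p : ℝ))) ^ 2 * ((m : ℝ) / m.totient) := by
  set Pz := Nat.primesBelow z with hPz
  set f : ℕ → ℝ := fun p => 1 - 1 / (p : ℝ) with hf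
  have hprime : ∀ p ∈ Pz, p.Prime := fun p hp => (Nat.mem_primesBelow.1 hp).2
  have hf0 : ∀ p : ℕ, p.Prime → 0 < f p := fun p hp => by
    have : (2 : ℝ) ≤ p := by exact_mod_cast hp.two_le
    rw [hf]; simp only
    rw [sub_pos, div_lt_one (by linarith)]; linarith
  have hf1 : ∀ p : ℕ, p.Prime → f p ≤ 1 := fun p hp => by
    rw [hf]; simp only
    have : (0 : ℝ) ≤ 1 / p := by positivity
    linarith
  -- termwise comparison with `g p = f p` (`p ∣ m`) or `f p ^ 2` (`p ∤ m`)
  have hterm : ∀ p ∈ Pz, (1 - (#({0, m % p} : Finset ℕ) : ℝ) / p) ≤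
      if p ∣ m then f p else f p ^ 2 := by
    intro p hp
    have hpp := hprime p hp
    have hp2 : (2 : ℝ) ≤ p := by exact_mod_cast hpp.two_le
    rw [card_pair_zero_mod m p]
    split_ifs with hdiv
    · simp [hf]
    · rw [hf]
      simp only
      push_cast
      have hp0 : (p : ℝ) ≠ 0 := by positivity
      field_simp
      nlinarith
  have hnonneg : ∀ p ∈ Pz, 0 ≤ (1 - (#({0, m % p} : Finset ℕ) : ℝ) / p) := by
    intro p hp
    have hpp := hprime p hp
    have hp2 : (2 : ℝ) ≤ p := by exact_mod_cast hpp.two_le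
    rw [card_pair_zero_mod m p, sub_nonneg, div_le_one (by linarith)]
    split_ifs <;> push_cast <;> linarith
  have h1 : ∏ p ∈ Pz, (1 - (#({0, m % p} : Finset ℕ) : ℝ) / p) ≤
      ∏ p ∈ Pz, (if p ∣ m then f p else f p ^ 2) := prod_le_prod hnonneg hterm
  rw [prod_ite] at h1
  set D := Pz.filter (fun p => p ∣ m) with hD
  set E := Pz.filter (fun p => ¬ p ∣ m) with hE
  have hsplit : ∏ p ∈ Pz, f p = (∏ p ∈ D, f p) * ∏ p ∈ E, f p :=
    (prod_filter_mul_prod_filter_not Pz (fun p => p ∣ m) f).symm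
  -- `φ(m)/m ≤ ∏_D f`
  have hD0 : 0 < ∏ p ∈ D, f p := prod_pos fun p hp => hf0 p (hprime p (mem_filter.1 hp).1)
  have hE0 : 0 ≤ ∏ p ∈ E, f p := prod_nonneg fun p hp => (hf0 p (hprime p (mem_filter.1 hp).1)).le
  have hm0 : (0 : ℝ) < m := by exact_mod_cast hm
  have hφ0 : (0 : ℝ) < m.totient := by exact_mod_cast Nat.totient_pos.2 hm
  have hkey : (m.totient : ℝ) / m ≤ ∏ p ∈ D, f p := by
    rw [LFunctions.MertensBound.totient_eq_mul_prod_one_sub_inv m, mul_div_cancel_left₀ _ hm0.ne']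
    refine Finset.prod_le_prod_of_subset_of_le_one (fun p hp => ?_)
      (fun p hp => (hf0 p (Nat.prime_of_mem_primeFactors hp)).le)
      (fun p hp _ => hf1 p (Nat.prime_of_mem_primeFactors hp))
    have hp := mem_filter.1 hp
    exact Nat.mem_primeFactors.2 ⟨hprime p hp.1, hp.2, by omega⟩
  have hkey' : 1 ≤ (∏ p ∈ D, f p) * ((m : ℝ) / m.totient) := by
    rw [div_le_iff₀ hm0] at hkey
    rw [← mul_div_assoc, one_le_div hφ0]
    linarith
  refine h1.trans ?_
  calc (∏ p ∈ D, f p) * ∏ p ∈ E, f p ^ 2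
      = (∏ p ∈ D, f p) * (∏ p ∈ E, f p) ^ 2 * 1 := by rw [prod_pow, mul_one]
    _ ≤ (∏ p ∈ D, f p) * (∏ p ∈ E, f p) ^ 2 * ((∏ p ∈ D, f p) * ((m : ℝ) / m.totient)) := by
        gcongr
    _ = (∏ p ∈ Pz, f p) ^ 2 * ((m : ℝ) / m.totient) := by rw [hsplit]; ring

/-- `∑_{p < z} ν(p)/p ≤ 2 (log log z + 4)` for `ν(p) ≤ 2`, `z ≥ 2`
(`Literature.NumberTheory.LFunctions.MertensBound.sum_inv_prime_le`). [folklore] -/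
theorem sum_localDensity_div_le (z m : ℕ) (hz : 2 ≤ z) :
    ∑ p ∈ Nat.primesBelow z, (#({0, m % p} : Finset ℕ) : ℝ) / p ≤
      2 * (Real.log (Real.log z) + 4) := by
  have h1 : ∑ p ∈ Nat.primesBelow z, (#({0, m % p} : Finset ℕ) : ℝ) / p ≤
      ∑ p ∈ Nat.primesBelow z, 2 * (1 / (p : ℝ)) := by
    refine sum_le_sum fun p hp => ?_
    have hcard : (#({0, m % p} : Finset ℕ) : ℝ) ≤ 2 := by exact_mod_cast card_le_two
    rw [mul_one_div]
    gcongr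
  have h2 : ∑ p ∈ Nat.primesBelow z, 2 * (1 / (p : ℝ)) ≤ ∑ p ∈ Nat.primesLE z, 2 * (1 / (p : ℝ)) := by
    refine sum_le_sum_of_subset_of_nonneg (fun p hp => ?_) fun p _ _ => by positivity
    rw [Nat.mem_primesBelow] at hp
    exact Nat.mem_primesLE.2 ⟨hp.1.le, hp.2⟩
  have h3 := LFunctions.MertensBound.sum_inv_prime_le z hz
  calc _ ≤ _ := h1
    _ ≤ _ := h2
    _ = 2 * ∑ p ∈ Nat.primesLE z, (1 / (p : ℝ)) := by rw [mul_sum]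
    _ ≤ 2 * (Real.log (Real.log z) + 4) := by gcongr

/-- **The Rankin tail**: for `λ > 0`,
`∑_{#S = r+1} ∏_{p ∈ S} ν(p)/p ≤ λ^{-(r+1)} exp(2λ (log log z + 4))`. [folklore] -/
theorem rankin_tail_le (z m r : ℕ) (hz : 2 ≤ z) {lam : ℝ} (hlam : 0 < lam) :
    ∑ S ∈ (Nat.primesBelow z).powersetCard (r + 1),
        ∏ p ∈ S, ((#({0, m % p} : Finset ℕ) : ℝ) / p) ≤
      (lam ^ (r + 1))⁻¹ * Real.exp (lam * (2 * (Real.log (Real.log z) + 4))) := by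
  have h := BrunPureSieve.esymm_le_inv_pow_mul_exp (Nat.primesBelow z)
    (fun p => (#({0, m % p} : Finset ℕ) : ℝ) / p) (fun p _ => by positivity) (r + 1) hlam
  refine h.trans ?_
  gcongr
  exact sum_localDensity_div_le z m hz

/-- **The error term**: `∑_{k ≤ r} ∑_{#S = k} ∏_{p ∈ S} ν(p) ≤ (r + 1) (2z)^r`. [folklore] -/
theorem error_term_le (z m r : ℕ) (hz : 1 ≤ z) :
    ∑ k ∈ range (r + 1), ∑ S ∈ (Nat.primesBelow z).powersetCard k,
        ∏ p ∈ S, (#({0, m % p} : Finset ℕ) : ℝ) ≤ (r + 1) * (2 * (z : ℝ)) ^ r := by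
  have hn : #(Nat.primesBelow z) ≤ z := by
    calc #(Nat.primesBelow z) ≤ #(range z) := card_le_card (filter_subset _ _)
      _ = z := card_range z
  have hz1 : (1 : ℝ) ≤ 2 * z := by
    have : (1 : ℝ) ≤ z := by exact_mod_cast hz
    linarith
  have hk : ∀ k ∈ range (r + 1), ∑ S ∈ (Nat.primesBelow z).powersetCard k,
      ∏ p ∈ S, (#({0, m % p} : Finset ℕ) : ℝ) ≤ (2 * (z : ℝ)) ^ r := by
    intro k hkr
    have hkr' : k ≤ r := Nat.lt_succ_iff.1 (mem_range.1 hkr)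
    calc ∑ S ∈ (Nat.primesBelow z).powersetCard k, ∏ p ∈ S, (#({0, m % p} : Finset ℕ) : ℝ)
        ≤ ∑ S ∈ (Nat.primesBelow z).powersetCard k, (2 : ℝ) ^ k := by
          refine sum_le_sum fun S hS => ?_
          have hSk : #S = k := (mem_powersetCard.1 hS).2
          calc ∏ p ∈ S, (#({0, m % p} : Finset ℕ) : ℝ) ≤ ∏ p ∈ S, (2 : ℝ) :=
                prod_le_prod (fun p _ => by positivity) fun p _ => by exact_mod_cast card_le_two
            _ = 2 ^ k := by rw [prod_const, hSk]
      _ = ((#(Nat.primesBelow z)).choose k : ℝ) * 2 ^ k := by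
          rw [sum_const, card_powersetCard, nsmul_eq_mul]
      _ ≤ (z : ℝ) ^ k * 2 ^ k := by
          gcongr
          calc ((#(Nat.primesBelow z)).choose k : ℝ) ≤ (#(Nat.primesBelow z) : ℝ) ^ k := by
                have := Nat.choose_le_pow_div k (#(Nat.primesBelow z)) (α := ℝ)
                refine this.trans (div_le_self (by positivity) ?_)
                exact_mod_cast Nat.one_le_iff_ne_zero.mpr (Nat.factorial_ne_zero k)
            _ ≤ (z : ℝ) ^ k := by gcongr
      _ = (2 * (z : ℝ)) ^ k := by rw [mul_pow]; ring
      _ ≤ (2 * (z : ℝ)) ^ r := pow_le_pow_right₀ hz1 hkr'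
  calc _ ≤ ∑ k ∈ range (r + 1), (2 * (z : ℝ)) ^ r := sum_le_sum hk
    _ = (r + 1) * (2 * (z : ℝ)) ^ r := by rw [sum_const, card_range, nsmul_eq_mul]; push_cast; rfl

/-- `m/φ(m) ≤ 3⁹ + 4e⁵ log log N` for `1 ≤ m ≤ 2N`, `N ≥ 8`
(`Literature.NumberTheory.LFunctions.MertensBound.totient_div_self_ge`). [folklore] -/
theorem self_div_totient_le {m N : ℕ} (hm : 1 ≤ m) (hmN : m ≤ 2 * N) (hN : 8 ≤ N) :
    (m : ℝ) / m.totient ≤ 3 ^ 9 + 4 * Real.exp 5 * Real.log (Real.log N) := by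
  have hN' : (8 : ℝ) ≤ N := by exact_mod_cast hN
  have hlogN : 2 < Real.log N := by
    rw [Real.lt_log_iff_exp_lt (by linarith)]
    have h1 : Real.exp 2 = Real.exp 1 * Real.exp 1 := by rw [← Real.exp_add]; norm_num
    rw [h1]
    nlinarith [Real.exp_one_lt_d9, Real.exp_pos 1]
  have hll : Real.log 2 < Real.log (Real.log N) :=
    Real.log_lt_log (by norm_num) hlogN
  have hll0 : 0 < Real.log (Real.log N) := (Real.log_pos one_lt_two).trans hll
  have hφ0 : (0 : ℝ) < m.totient := by exact_mod_cast Nat.totient_pos.2 hm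
  by_cases hbig : 3 ^ 9 ≤ m
  · have h := LFunctions.MertensBound.totient_div_self_ge m hbig
    have hm0 : (0 : ℝ) < m := by exact_mod_cast hm
    have hm3 : (3 : ℝ) ^ 9 ≤ m := by exact_mod_cast hbig
    -- `log log m ≤ 2 log log N`
    have hlogm : 1 < Real.log m := by
      rw [Real.lt_log_iff_exp_lt hm0]
      linarith [Real.exp_one_lt_three]
    have hllm : 0 < Real.log (Real.log m) := Real.log_pos hlogm
    have hllm2 : Real.log (Real.log m) ≤ 2 * Real.log (Real.log N) := by
      have h1 : Real.log m ≤ Real.log 2 + Real.log N := by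
        rw [← Real.log_mul (by norm_num) (by linarith)]
        exact Real.log_le_log hm0 (by exact_mod_cast hmN)
      have h2 : Real.log 2 + Real.log N ≤ 2 * Real.log N := by
        have := Real.log_two_lt_d9
        linarith
      calc Real.log (Real.log m) ≤ Real.log (2 * Real.log N) :=
            Real.log_le_log (by linarith) (h1.trans h2)
        _ = Real.log 2 + Real.log (Real.log N) := by
            rw [Real.log_mul (by norm_num) (by linarith)]
        _ ≤ 2 * Real.log (Real.log N) := by linarith
    -- from `e^{-5}/(2 log log m) ≤ φ/m`
    have h' : (m : ℝ) / m.totient ≤ 2 * Real.exp 5 * Real.log (Real.log m) := by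
      rw [div_le_iff₀ hφ0]
      rw [div_le_div_iff₀ (by positivity) hm0] at h
      have : Real.exp (-5) * Real.exp 5 = 1 := by rw [← Real.exp_add]; simp
      nlinarith [Real.exp_pos 5, Real.exp_pos (-5)]
    calc (m : ℝ) / m.totient ≤ 2 * Real.exp 5 * Real.log (Real.log m) := h'
      _ ≤ 2 * Real.exp 5 * (2 * Real.log (Real.log N)) := by gcongr
      _ ≤ 3 ^ 9 + 4 * Real.exp 5 * Real.log (Real.log N) := by
          nlinarith [Real.exp_pos 5, hll0]
  · rw [not_le] at hbig
    have h1 : (m : ℝ) / m.totient ≤ m := by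
      rw [div_le_iff₀ hφ0]
      have : (1 : ℝ) ≤ m.totient := by exact_mod_cast Nat.totient_pos.2 hm
      nlinarith
    have h2 : (m : ℝ) ≤ 3 ^ 9 := by exact_mod_cast hbig.le
    nlinarith [Real.exp_pos 5]

/-! ### The upper bound for Goldbach-type representations -/

/-- Local helper: `2.718 ≤ e ≤ 2.72` (Mathlib `Real.exp_one_gt_d9`, `Real.exp_one_lt_d9`).
[folklore] -/
private theorem exp_one_bounds : Real.exp 1 ≤ 2.72 ∧ 2.718 ≤ Real.exp 1 :=
  ⟨Real.exp_one_lt_d9.le.trans (by norm_num), (by norm_num : (2.718 : ℝ) ≤ 2.7182818283).trans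
    Real.exp_one_gt_d9.le⟩

/-- **Upper bound for Goldbach-type representations** (Brun; cf. Halberstam–Richert,
*Sieve Methods*, Thm 3.11, which gives the sharp order `𝔖(m) N / log² N` by Selberg's sieve):
there are `C, N₀` such that for `N ≥ N₀` and every `1 ≤ m ≤ 2N`,
`#{n ≤ N : n, m - n prime} ≤ C N (log log N)³ / (log N)²`.
Proof: Brun's pure sieve with `z = exp(log N / (40 log log N))`, `r ≈ 10 log log N` terms,
Rankin's bound for the tail, Mertens' product bound and `m/φ(m) ≪ log log m`; the pure sieve
loses a factor `(log log N)³` against the Selberg-sieve order (the quadruple count of Tao 2016,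
footnote 5, is not obtained along this route; see the module docstring).
[cite: CojocaruMurty2005, §6.1] -/
theorem exists_repCount_le :
    ∃ C : ℝ, ∃ N₀ : ℕ, 0 < C ∧ ∀ N : ℕ, N₀ ≤ N → ∀ m : ℕ, 1 ≤ m → m ≤ 2 * N →
      (repCount N m : ℝ) ≤ C * N * (Real.log (Real.log N)) ^ 3 / (Real.log N) ^ 2 := by
  obtain ⟨C₂, z₀, hC₂, hMert⟩ : ∃ C₂ : ℝ, ∃ z₀ : ℕ, 0 < C₂ ∧ ∀ z : ℕ, z₀ ≤ z →
      ∏ p ∈ Nat.primesBelow z, (1 - 1 / (p : ℝ)) ≤ C₂ / Real.log z := by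
    refine ⟨1, 2, one_pos, fun z hz => ?_⟩
    have h := BombieriSieve.prod_primesBelow_one_sub_inv_le (z := (z : ℝ))
      (by exact_mod_cast (lt_of_lt_of_le one_lt_two hz))
    rw [Nat.ceil_natCast] at h
    simpa only [one_div] using h
  obtain ⟨he1, he2⟩ := exp_one_bounds
  set C₃ : ℝ := 3 ^ 9 + 4 * Real.exp 5 with hC₃
  have hC₃0 : 0 < C₃ := by positivity
  set u₀ : ℝ := max (2 * Real.log 2) (Real.log (2 * (z₀ + 2))) with hu₀
  have hu₀0 : 0 < u₀ := lt_max_of_lt_left (by positivity)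
  set ℓ₀ : ℝ := max 6 (80 * u₀) with hℓ₀
  set K : ℝ := 6400 * C₂ ^ 2 * C₃ with hK
  have hK0 : 0 ≤ K := by positivity
  refine ⟨3 + K, ⌈Real.exp (Real.exp ℓ₀)⌉₊, by positivity, ?_⟩
  intro N hN m hm hmN
  -- powers of `e`
  have he4 : (54 : ℝ) ≤ Real.exp 4 := by
    have h : Real.exp 4 = (Real.exp 1) ^ 4 := by rw [← Real.exp_nat_mul]; norm_num
    rw [h]
    exact le_trans (by norm_num) (pow_le_pow_left₀ (by norm_num) he2 4)
  have he6 : (403 : ℝ) ≤ Real.exp 6 := by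
    have h : Real.exp 6 = (Real.exp 1) ^ 6 := by rw [← Real.exp_nat_mul]; norm_num
    rw [h]
    exact le_trans (by norm_num) (pow_le_pow_left₀ (by norm_num) he2 6)
  have he2' : Real.exp 2 ≤ 7.4 := by
    have h : Real.exp 2 = Real.exp 1 * Real.exp 1 := by rw [← Real.exp_add]; norm_num
    rw [h]
    calc Real.exp 1 * Real.exp 1 ≤ 2.72 * 2.72 :=
          mul_le_mul he1 he1 (Real.exp_pos 1).le (by norm_num)
      _ ≤ 7.4 := by norm_num
  have hlog2 : Real.log 2 ≤ 0.7 := Real.log_two_lt_d9.le.trans (by norm_num)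
  have hlog2' : 0 ≤ Real.log 2 := Real.log_nonneg one_le_two
  -- the basic parameters
  have hN1 : Real.exp (Real.exp ℓ₀) ≤ N := (Nat.le_ceil _).trans (by exact_mod_cast hN)
  have hN0 : (0 : ℝ) < N := (Real.exp_pos _).trans_le hN1
  set L : ℝ := Real.log N with hL
  set ℓ : ℝ := Real.log L with hℓ
  have hLexp : Real.exp ℓ₀ ≤ L := by
    rw [hL, ← Real.log_exp (Real.exp ℓ₀)]
    exact Real.log_le_log (Real.exp_pos _) hN1
  have hL0 : 0 < L := (Real.exp_pos _).trans_le hLexp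
  have hℓℓ₀ : ℓ₀ ≤ ℓ := by
    rw [hℓ, ← Real.log_exp ℓ₀]
    exact Real.log_le_log (Real.exp_pos _) hLexp
  have hℓ6 : 6 ≤ ℓ := (le_max_left _ _).trans hℓℓ₀
  have hℓ0 : 0 < ℓ := by linarith only [hℓ6]
  have hexpℓ : Real.exp ℓ = L := by rw [hℓ, Real.exp_log hL0]
  have hexpL : Real.exp L = N := by rw [hL, Real.exp_log hN0]
  -- `L = e^ℓ ≥ 403 (ℓ - 5)`
  have hL403 : 403 * (ℓ - 5) ≤ L := by
    rw [← hexpℓ]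
    have h1 : Real.exp ℓ = Real.exp 6 * Real.exp (ℓ - 6) := by
      rw [← Real.exp_add]; ring_nf
    have h3 : ℓ - 6 + 1 ≤ Real.exp (ℓ - 6) := Real.add_one_le_exp _
    rw [h1]
    calc 403 * (ℓ - 5) ≤ Real.exp 6 * (ℓ - 5) := by
          apply mul_le_mul_of_nonneg_right he6; linarith only [hℓ6]
      _ ≤ Real.exp 6 * Real.exp (ℓ - 6) := by
          apply mul_le_mul_of_nonneg_left _ (Real.exp_pos 6).le; linarith only [h3]
  have hL8 : (8 : ℝ) ≤ N := by
    rw [← hexpL]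
    have : (8 : ℝ) ≤ L + 1 := by linarith only [hL403, hℓ6]
    exact this.trans (Real.add_one_le_exp L)
  have hN8 : 8 ≤ N := by exact_mod_cast hL8
  -- `u`
  set u : ℝ := L / (40 * ℓ) with hu
  have hu_ge : ℓ / 80 ≤ u := by
    rw [hu, div_le_div_iff₀ (by norm_num) (by positivity)]
    have h1 : ℓ ^ 2 / 2 ≤ L := by
      rw [← hexpℓ]
      have := Real.pow_div_factorial_le_exp ℓ hℓ0.le 2
      simpa using this
    have h2 : ℓ * (40 * ℓ) = 80 * (ℓ ^ 2 / 2) := by ring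
    rw [h2]
    linarith only [h1]
  have huu₀ : u₀ ≤ u := by
    have : 80 * u₀ ≤ ℓ := (le_max_right _ _).trans hℓℓ₀
    linarith only [this, hu_ge]
  have hu2 : 2 * Real.log 2 ≤ u := (le_max_left _ _).trans huu₀
  have hu0 : 0 < u := hu₀0.trans_le huu₀
  have huL : u ≤ L / 240 := by
    rw [hu, div_le_div_iff₀ (by positivity) (by norm_num)]
    have := mul_le_mul_of_nonneg_left (show (240 : ℝ) ≤ 40 * ℓ by linarith only [hℓ6]) hL0.le
    linarith only [this]
  -- `z`
  set z : ℕ := ⌊Real.exp u⌋₊ with hz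
  have hz_le : (z : ℝ) ≤ Real.exp u := Nat.floor_le (Real.exp_pos u).le
  have hz_gt : Real.exp u - 1 < z := by
    have := Nat.lt_floor_add_one (Real.exp u)
    rw [← hz] at this; linarith only [this]
  have hexpu2 : 2 * (z₀ + 2 : ℝ) ≤ Real.exp u := by
    have h1 : Real.log (2 * (z₀ + 2)) ≤ u := (le_max_right _ _).trans huu₀
    have := Real.exp_le_exp.2 h1
    rwa [Real.exp_log (by positivity)] at this
  have hz_half : Real.exp u / 2 ≤ z := by
    have : (0 : ℝ) ≤ z₀ := Nat.cast_nonneg z₀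
    linarith only [hz_gt, hexpu2, this]
  have hzz₀ : z₀ ≤ z := by
    have : (z₀ : ℝ) ≤ z := by linarith only [hz_gt, hexpu2]
    exact_mod_cast this
  have hz2 : 2 ≤ z := by
    have h0 : (0 : ℝ) ≤ z₀ := Nat.cast_nonneg z₀
    have : (2 : ℝ) ≤ z := by linarith only [hz_gt, hexpu2, h0]
    exact_mod_cast this
  have hz1 : 1 ≤ z := by omega
  have hzr0 : (0 : ℝ) < z := by exact_mod_cast (by omega : 0 < z)
  have hlogz_le : Real.log z ≤ u := by
    have := Real.log_le_log hzr0 hz_le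
    rwa [Real.log_exp] at this
  have hlogz_ge : u / 2 ≤ Real.log z := by
    have h1 : Real.log (Real.exp u / 2) ≤ Real.log z := Real.log_le_log (by positivity) hz_half
    rw [Real.log_div (Real.exp_pos u).ne' (by norm_num), Real.log_exp] at h1
    linarith only [h1, hu2]
  have hlogz0 : 0 < Real.log z := by linarith only [hlogz_ge, hu0]
  have hllz : Real.log (Real.log z) ≤ ℓ := by
    rw [hℓ]
    exact Real.log_le_log hlogz0 (hlogz_le.trans (by linarith only [huL, hL0]))
  -- `r`
  set r : ℕ := 2 * ⌈5 * ℓ⌉₊ + 40 with hr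
  have hr_even : Even r := ⟨⌈5 * ℓ⌉₊ + 20, by rw [hr]; ring⟩
  have hr_ge : 10 * ℓ + 41 ≤ (r : ℝ) + 1 := by
    have : 5 * ℓ ≤ ⌈5 * ℓ⌉₊ := Nat.le_ceil _
    rw [hr]; push_cast; linarith only [this]
  have hr_le : (r : ℝ) ≤ 10 * ℓ + 42 := by
    have : (⌈5 * ℓ⌉₊ : ℝ) < 5 * ℓ + 1 := Nat.ceil_lt_add_one (by positivity)
    rw [hr]; push_cast; linarith only [this]
  have hr0 : (0 : ℝ) ≤ r := Nat.cast_nonneg r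
  -- the sieve
  set A : ℕ → Finset ℕ := fun p => ({0, m % p} : Finset ℕ) with hA
  have hAp : ∀ p ∈ Nat.primesBelow z, ∀ x ∈ A p, x < p := by
    intro p hp x hx
    have hpp := (Nat.mem_primesBelow.1 hp).2
    rw [hA] at hx
    simp only [mem_insert, mem_singleton] at hx
    rcases hx with rfl | rfl
    · exact hpp.pos
    · exact Nat.mod_lt _ hpp.pos
  have hsieve := brun_sieve_local N (Nat.primesBelow z) (fun p hp => (Nat.mem_primesBelow.1 hp).2)
    A hAp hr_even
  have hred := repCount_le_sifted N m z
  -- main term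
  have hmain : ∏ p ∈ Nat.primesBelow z, (1 - (#(A p) : ℝ) / p) ≤ K * ℓ ^ 3 / L ^ 2 := by
    have h1 := prod_one_sub_localDensity_le z hm
    have h2 := hMert z hzz₀
    have h3 := self_div_totient_le hm hmN hN8
    have h4 : (m : ℝ) / m.totient ≤ C₃ * ℓ := by
      refine h3.trans ?_
      rw [hC₃]
      have : (3 : ℝ) ^ 9 ≤ 3 ^ 9 * ℓ := le_mul_of_one_le_right (by norm_num) (by linarith only [hℓ6])
      linarith only [this]
    have h5 : C₂ / Real.log z ≤ 2 * C₂ / u := by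
      rw [div_le_div_iff₀ hlogz0 hu0]
      have := mul_le_mul_of_nonneg_left hlogz_ge hC₂.le
      linarith only [this]
    have hprod0 : 0 ≤ ∏ p ∈ Nat.primesBelow z, (1 - 1 / (p : ℝ)) :=
      prod_nonneg fun p hp => by
        have : (2 : ℝ) ≤ p := by exact_mod_cast (Nat.mem_primesBelow.1 hp).2.two_le
        rw [sub_nonneg, div_le_one (by linarith only [this])]; linarith only [this]
    calc ∏ p ∈ Nat.primesBelow z, (1 - (#(A p) : ℝ) / p)
        ≤ (∏ p ∈ Nat.primesBelow z, (1 - 1 / (p : ℝ))) ^ 2 * ((m : ℝ) / m.totient) := h1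
      _ ≤ (2 * C₂ / u) ^ 2 * (C₃ * ℓ) := by
          gcongr
          exact h2.trans h5
      _ = K * ℓ ^ 3 / L ^ 2 := by
          rw [hK, hu]
          field_simp
          ring
  -- Rankin tail
  have htail : ∑ S ∈ (Nat.primesBelow z).powersetCard (r + 1), ∏ p ∈ S, ((#(A p) : ℝ) / p) ≤
      1 / L ^ 2 := by
    have h1 := rankin_tail_le z m r hz2 (Real.exp_pos 2)
    refine h1.trans ?_
    rw [← Real.exp_nat_mul, ← Real.exp_neg, ← Real.exp_add]
    have a1 : Real.exp 2 * (2 * (Real.log (Real.log z) + 4)) ≤ Real.exp 2 * (2 * (ℓ + 4)) := by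
      gcongr
    have a2 : Real.exp 2 * (2 * (ℓ + 4)) ≤ 7.4 * (2 * (ℓ + 4)) :=
      mul_le_mul_of_nonneg_right he2' (by linarith only [hℓ6])
    have hexp : -((r + 1 : ℕ) * (2 : ℝ)) + Real.exp 2 * (2 * (Real.log (Real.log z) + 4)) ≤
        -(2 * ℓ) := by
      push_cast
      linarith only [a1, a2, hr_ge, hℓ6]
    calc Real.exp (-((r + 1 : ℕ) * (2 : ℝ)) + Real.exp 2 * (2 * (Real.log (Real.log z) + 4)))
        ≤ Real.exp (-(2 * ℓ)) := Real.exp_le_exp.2 hexp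
      _ = 1 / L ^ 2 := by
          rw [Real.exp_neg, show (2 : ℝ) * ℓ = (2 : ℕ) * ℓ by norm_num, Real.exp_nat_mul, hexpℓ,
            one_div]
  -- error term
  have hNL : Real.exp (L - 2 * ℓ) = N / L ^ 2 := by
    rw [Real.exp_sub, hexpL, show (2 : ℝ) * ℓ = (2 : ℕ) * ℓ by norm_num, Real.exp_nat_mul, hexpℓ]
  have herr : ∑ k ∈ range (r + 1), ∑ S ∈ (Nat.primesBelow z).powersetCard k,
      ∏ p ∈ S, (#(A p) : ℝ) ≤ N / L ^ 2 := by
    have h1 := error_term_le z m r hz1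
    refine h1.trans ?_
    rw [← hNL]
    -- `(2z)^r ≤ exp(r (log 2 + u))`
    have h2 : (2 * (z : ℝ)) ^ r ≤ Real.exp (r * (Real.log 2 + u)) := by
      rw [Real.exp_nat_mul, Real.exp_add, Real.exp_log (by norm_num)]
      gcongr
    -- `r + 1 ≤ exp(ℓ + 4)`
    have h3 : (r : ℝ) + 1 ≤ Real.exp (ℓ + 4) := by
      have h31 : Real.exp (ℓ + 4) = Real.exp 4 * Real.exp ℓ := by rw [← Real.exp_add]; ring_nf
      have h33 : ℓ + 1 ≤ Real.exp ℓ := Real.add_one_le_exp ℓ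
      rw [h31]
      calc (r : ℝ) + 1 ≤ 54 * (ℓ + 1) := by linarith only [hr_le, hℓ6]
        _ ≤ Real.exp 4 * Real.exp ℓ :=
            mul_le_mul he4 h33 (by linarith only [hℓ6]) (Real.exp_pos 4).le
    have h4 : (r : ℝ) * (Real.log 2 + u) ≤ L / 2 + 7 * ℓ + 29.4 := by
      have h41 : (r : ℝ) * u ≤ L / 2 := by
        calc (r : ℝ) * u ≤ (10 * ℓ + 42) * u := by gcongr
          _ = (10 * ℓ + 42) * L / (40 * ℓ) := by rw [hu]; ring
          _ ≤ L / 2 := by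
              rw [div_le_iff₀ (by positivity)]
              have := mul_le_mul_of_nonneg_right (show (42 : ℝ) ≤ 10 * ℓ by linarith only [hℓ6])
                hL0.le
              linarith only [this]
      have h42 : (r : ℝ) * Real.log 2 ≤ (10 * ℓ + 42) * 0.7 :=
        mul_le_mul hr_le hlog2 hlog2' (by linarith only [hℓ6])
      have : (r : ℝ) * (Real.log 2 + u) = r * Real.log 2 + r * u := by ring
      rw [this]
      linarith only [h41, h42]
    have h5 : L / 2 + 7 * ℓ + 29.4 + (ℓ + 4) ≤ L - 2 * ℓ := by linarith only [hL403, hℓ6]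
    calc ((r : ℝ) + 1) * (2 * (z : ℝ)) ^ r
        ≤ Real.exp (ℓ + 4) * Real.exp (r * (Real.log 2 + u)) := by
          gcongr
      _ = Real.exp (r * (Real.log 2 + u) + (ℓ + 4)) := by rw [← Real.exp_add]; ring_nf
      _ ≤ Real.exp (L - 2 * ℓ) := Real.exp_le_exp.2 (by linarith only [h4, h5])
  -- `2z ≤ N / L²`
  have hzN : 2 * (z : ℝ) ≤ N / L ^ 2 := by
    rw [← hNL]
    have h1 : 2 * (z : ℝ) ≤ Real.exp (Real.log 2 + u) := by
      rw [Real.exp_add, Real.exp_log (by norm_num)]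
      gcongr
    have h2 : Real.log 2 + u ≤ L - 2 * ℓ := by linarith only [hlog2, huL, hL403, hℓ6]
    exact h1.trans (Real.exp_le_exp.2 h2)
  -- assemble
  have hℓ3 : 1 ≤ ℓ ^ 3 := one_le_pow₀ (by linarith only [hℓ6])
  have hsifted : (#{n ∈ Icc 1 N | ∀ p ∈ Nat.primesBelow z, n % p ∉ A p} : ℝ) ≤
      N * (K * ℓ ^ 3 / L ^ 2 + 1 / L ^ 2) + N / L ^ 2 := by
    refine hsieve.trans ?_
    gcongr
  have hfin : (2 + K * ℓ ^ 3 + 1) ≤ (3 + K) * ℓ ^ 3 := by nlinarith only [hℓ3, hK0]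
  calc (repCount N m : ℝ)
      ≤ 2 * z + #{n ∈ Icc 1 N | ∀ p ∈ Nat.primesBelow z, n % p ∉ A p} := hred
    _ ≤ N / L ^ 2 + (N * (K * ℓ ^ 3 / L ^ 2 + 1 / L ^ 2) + N / L ^ 2) :=
        add_le_add hzN hsifted
    _ = (2 + K * ℓ ^ 3 + 1) * N / L ^ 2 := by
        field_simp
        ring
    _ ≤ (3 + K) * ℓ ^ 3 * N / L ^ 2 := by gcongr
    _ = (3 + K) * N * ℓ ^ 3 / L ^ 2 := by ring

/-- **Upper bound for the Goldbach representation number** (same bound for the tree's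
`Literature.NumberTheory.Sieve.SingularSeries.goldbachCount`): there are `C, N₀` such that for `N ≥ N₀` and every `1 ≤ m ≤ 2N`,
`goldbachCount m ≤ C N (log log N)³ / (log N)²` (from `exists_repCount_le` and
`goldbachCount m ≤ 2 R_N(m)`). [cite: CojocaruMurty2005, §6.1] -/
theorem exists_goldbachCount_le :
    ∃ C : ℝ, ∃ N₀ : ℕ, 0 < C ∧ ∀ N : ℕ, N₀ ≤ N → ∀ m : ℕ, 1 ≤ m → m ≤ 2 * N →
      (SingularSeries.goldbachCount m : ℝ) ≤ C * N * (Real.log (Real.log N)) ^ 3 / (Real.log N) ^ 2 := by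
  obtain ⟨C, N₀, hC, h⟩ := exists_repCount_le
  refine ⟨2 * C, N₀, by positivity, fun N hN m hm1 hm2 => ?_⟩
  have h1 : (SingularSeries.goldbachCount m : ℝ) ≤ 2 * repCount N m := by
    exact_mod_cast goldbachCount_le_two_mul_repCount hm2
  have h2 := h N hN m hm1 hm2
  calc (SingularSeries.goldbachCount m : ℝ) ≤ 2 * repCount N m := h1
    _ ≤ 2 * (C * N * (Real.log (Real.log N)) ^ 3 / (Real.log N) ^ 2) := by linarith
    _ = 2 * C * N * (Real.log (Real.log N)) ^ 3 / (Real.log N) ^ 2 := by ring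

/-! ### Additive quadruples of primes -/

/-- **Additive energy of a set of primes via representation counts**: if every `p ∈ 𝒫` is
prime and `goldbachCount(p₁ + p₂) ≤ R` for all `p₁, p₂ ∈ 𝒫`, then the additive energy
`E(𝒫, 𝒫) = #{(p₁,p₃,p₂,p₄) ∈ 𝒫⁴ : p₁ + p₂ = p₃ + p₄}` (Mathlib's `Finset.addEnergy`) is at most
`#𝒫² R` (fibre over `(p₁, p₂)`; the fibre injects into the representations of `p₁ + p₂` via
`(p₃, p₄)`). This is the quantity of footnote 5 of Tao 2016 (proof of Lemma 3.7); see the module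
docstring for what the resulting bound does and does not give.
[cite: TaoFMP2016, §3 (footnote to the proof of Lemma 3.7)] -/
theorem card_addQuadruples_le (P : Finset ℕ) (hP : ∀ p ∈ P, p.Prime) {R : ℝ}
    (hR : ∀ p₁ ∈ P, ∀ p₂ ∈ P, (SingularSeries.goldbachCount (p₁ + p₂) : ℝ) ≤ R) :
    (Finset.addEnergy P P : ℝ) ≤ (#P : ℝ) ^ 2 * R := by
  classical
  unfold Finset.addEnergy
  set T := ((P ×ˢ P) ×ˢ (P ×ˢ P)).filter (fun q => q.1.1 + q.2.1 = q.1.2 + q.2.2) with hT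
  set g : (ℕ × ℕ) × (ℕ × ℕ) → ℕ × ℕ := fun q => (q.1.1, q.2.1) with hg
  have hmaps : ∀ q ∈ T, g q ∈ P ×ˢ P := by
    intro q hq
    rw [hT, mem_filter, mem_product, mem_product, mem_product] at hq
    exact mem_product.2 ⟨hq.1.1.1, hq.1.2.1⟩
  rw [card_eq_sum_card_fiberwise hmaps]
  have hfib : ∀ c ∈ P ×ˢ P, (#{q ∈ T | g q = c} : ℝ) ≤ R := by
    intro c hc
    rw [mem_product] at hc
    obtain ⟨hc1, hc2⟩ := hc
    refine le_trans ?_ (hR _ hc1 _ hc2)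
    have key : #{q ∈ T | g q = c} ≤ SingularSeries.goldbachCount (c.1 + c.2) := by
      unfold SingularSeries.goldbachCount
      refine card_le_card_of_injOn (fun q : (ℕ × ℕ) × (ℕ × ℕ) => (q.1.2, q.2.2)) (fun q hq => ?_)
        (fun q hq q' hq' h => ?_)
      · dsimp only
        rw [mem_coe, mem_filter, hT, mem_filter, mem_product, mem_product, mem_product] at hq
        obtain ⟨⟨⟨⟨_, h12⟩, _, h22⟩, hsum⟩, hgq⟩ := hq
        rw [hg, Prod.ext_iff] at hgq
        simp only at hgq
        rw [mem_coe, mem_filter, HasAntidiagonal.mem_antidiagonal]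
        obtain ⟨hg1, hg2⟩ := hgq
        exact ⟨by rw [← hg1, ← hg2]; omega, (hP _ h12), (hP _ h22)⟩
      · dsimp only at h
        rw [mem_coe, mem_filter, hT, mem_filter] at hq hq'
        obtain ⟨_, hgq⟩ := hq
        obtain ⟨_, hgq'⟩ := hq'
        rw [hg, Prod.ext_iff] at hgq hgq'
        simp only [Prod.ext_iff] at hgq hgq' h
        have e1 : q.1.1 = q'.1.1 := by rw [hgq.1, hgq'.1]
        have e2 : q.2.1 = q'.2.1 := by rw [hgq.2, hgq'.2]
        exact Prod.ext (Prod.ext e1 h.1) (Prod.ext e2 h.2)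
    exact_mod_cast key
  push_cast
  calc ∑ c ∈ P ×ˢ P, (#{q ∈ T | g q = c} : ℝ) ≤ ∑ c ∈ P ×ˢ P, R := sum_le_sum hfib
    _ = (#P : ℝ) ^ 2 * R := by rw [sum_const, card_product, nsmul_eq_mul]; push_cast; ring

/-- Mathlib's additive energy is the tree's quadruple count: `E(𝒫, 𝒫) = #(addQuadruples 𝒫)`.
[folklore] -/
theorem addEnergy_eq_card_addQuadruples (P : Finset ℕ) :
    Finset.addEnergy P P = #(LFunctions.Tao2016.addQuadruples P) := rfl

/-- **The energy bound in the consumers' shape** (analogue of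
`ShiftedPrimePairs.exists_eventually_card_addQuadruples_le` with `(log log N)³`): there is `C` such
that for all large `N` and every set `𝒫` of primes `≤ N`,
`#(addQuadruples 𝒫) ≤ C N (log log N)³/(log N)² · #𝒫²`. [cite: TaoFMP2016, §3 Lemma 3.7 (footnote)] -/
theorem exists_eventually_card_addQuadruples_le :
    ∃ C : ℝ, 0 < C ∧ ∀ᶠ N : ℕ in Filter.atTop, ∀ P : Finset ℕ, (∀ p ∈ P, p.Prime ∧ p ≤ N) →
      (#(LFunctions.Tao2016.addQuadruples P) : ℝ) ≤
        C * N * Real.log (Real.log N) ^ 3 / Real.log N ^ 2 * #P ^ 2 := by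
  obtain ⟨C, N₀, hC, h⟩ := exists_goldbachCount_le
  refine ⟨C, hC, Filter.eventually_atTop.2 ⟨N₀, fun N hN P hP => ?_⟩⟩
  rw [← addEnergy_eq_card_addQuadruples]
  have hq := card_addQuadruples_le P (fun p hp => (hP p hp).1)
    (R := C * N * Real.log (Real.log N) ^ 3 / Real.log N ^ 2) (fun p₁ hp₁ p₂ hp₂ =>
      h N hN (p₁ + p₂) (by have := (hP p₁ hp₁).1.one_lt; omega)
        (by have := (hP p₁ hp₁).2; have := (hP p₂ hp₂).2; omega))
  linarith [hq]

end BrunGoldbach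

end Literature.NumberTheory.Sieve
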